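import Summits.FinalStateConjecture.FinalStateConjecture.Theorems.SwallowTheDatumKerrShieldedSettlesStubScriTransportAux
import Summits.FinalStateConjecture.FinalStateConjecture.Theorems.SwallowTheDatumKerrShieldedSettlesStubKerrLeafSojournAux2
import Literature.Geometry.Lorentzian.GeodesicMaximal
import Literature.Geometry.Lorentzian.LeviCivitaProofs
import Literature.Geometry.Lorentzian.IsometryProofs
import Literature.Geometry.Lorentzian.HypersurfaceRestriction
import Literature.Geometry.Riemannian.AHConvexNearInfinity
import HarnessLib

/-!
# `KerrShieldedSettles`, line `tapered-temporal-collar` — stub S5 `stub_scriTransport`, part 3: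
# lifting maximal null rays of a development through the chart map `χ`

Support file for crux `stmt-FinalStateConjecture-10054`
(`Summit.FinalStateConjecture.FinalStateConjecture.Theses.SwallowTheDatum.KerrShieldedSettles`), stub S5
`stub_scriTransport`.  The chart map `χ : Kerr.region a r₁ → N` of the line is smooth, isometric and oriented
only on the open tapered collar `W = {0 < x⁰ − T(r) + (r − r₁)/4}` of the ingoing Kerr–Schild chart.  This file
proves the transport engine of clause (a):

* `ScriTransport.ray_mem_collar` (registered sub-goal `stub_scriTransportRayCollar`) — a maximal null geodesic of
  the chart issuing from the bent leaf at radius `> 4M` with future-directed velocity stays in `W` for `t ≥ 0`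
  (positive Killing energy, `KerrLeafSojourn.ray_isFutureCausalCurveOn`, and the causal `u`-clock of part 1);
* `ScriTransport.ray_lift` — **a maximal geodesic `γ` of `(N, g)` through `χ(x₀)`, `x₀` on the leaf, with
  future-directed null velocity, is `χ ∘ γ_K` on `dom_K ∩ [0, ∞) ⊆ dom`**, where `γ_K` is the maximal chart
  geodesic with the pulled-back data: on the component `J ∋ 0` of `{t | γ_K t ∈ W}` the chart geodesic is a
  geodesic of the pulled-back metric `χ^* g` on `W` (same components `g_{M,a}`: `isGeodesicOn_transfer` of
  part 1), hence `χ ∘ γ_K` is a `g`-geodesic there (`SimpleAH.isGeodesicOn_comp`, O'Neill 1983, pp. 90–91) with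
  the data of `γ`, and maximality of `γ` (O'Neill 1983, Ch. 3, Prop. 3.24, `exists_isMaximalGeodesicOn`) gives
  `J ⊆ dom`, `γ = χ ∘ γ_K` on `J ⊇ dom_K ∩ [0, ∞)`.

References: B. O'Neill, *Semi-Riemannian geometry* (1983), Ch. 3, Lemma 3.22, Prop. 3.24, pp. 90–91;
D. Christodoulou, CQG 16 (1999) A23, p. A26; M. Dafermos, I. Rodnianski, arXiv:0811.0354, §2.6.2, §5.1.
-/

set_option linter.dupNamespace false

noncomputable section

open Set Filter Function
open scoped Manifold ContDiff Topology
open Literature.Geometry.Lorentzian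
open Summit.FinalStateConjecture.FinalStateConjecture.Theorems.KerrShieldedDataExist.Negative
  (bentHeight mass_pos)

namespace Summit.FinalStateConjecture.FinalStateConjecture.Theorems.SwallowTheDatum.KerrShieldedSettles

namespace ScriTransport

section Lift

variable [Kerr.Facts] {M a r₁ : ℝ}
  {N : Type*} [TopologicalSpace N] [ChartedSpace E4 N] [IsManifold (𝓡 4) ∞ N] [Nonempty N] [T2Space N]
  {g : LorentzianMetric (𝓡 4) ∞ N} {τ : TimeOrientation g} {χ : Kerr.region a r₁ → N}

/-- **A maximal null geodesic of the Kerr chart issuing from the bent leaf towards the future stays in the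
tapered collar `W` for all parameters `t ≥ 0`.**  If `γ` is a geodesic of `g_{M,a}` on the open interval
`dom ∋ 0` starting on the leaf `{x⁰ = T(r)}` at radius `> 4M` with future-directed null velocity, then
`0 < u(γ t) + (r(γ t) − r₁)/4` for `t ∈ dom`, `t ≥ 0`: the Killing energy is positive by the pinch
`E ≥ (1 − 4H)γ̇⁰ > 0` (`H ≤ M/r < 1/4`), so `γ` is a future causal chart curve on `dom`
(`KerrLeafSojourn.ray_isFutureCausalCurveOn`) and the `u`-clock applies (`curve_mem_collar`).
Dafermos–Rodnianski arXiv:0811.0354, §5.1. [cite: arXiv08110354, §5.1] -/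
theorem ray_mem_collar (hM : 0 ≤ M) (ha : |a| < M) [(Kerr.smoothMetric M a r₁).HasLeviCivita]
    {γ : ℝ → Kerr.region a r₁} {dom : Set ℝ} (hopen : IsOpen dom) (hoc : dom.OrdConnected)
    (hgeo : IsGeodesicOn (Kerr.smoothMetric M a r₁).leviCivita γ dom) (h0 : (0 : ℝ) ∈ dom)
    (hleaf : (γ 0 : E4) 0 = bentHeight M a (Kerr.radius a (γ 0 : E4)))
    (hfar : 4 * M < Kerr.radius a (γ 0 : E4))
    (hnull : (Kerr.smoothMetric M a r₁).IsNull (velocity 𝓘(ℝ, E4) γ 0))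
    (hfd : (((Kerr.timeOrientation M a r₁ hM).ofLE le_top :
      TimeOrientation (Kerr.smoothMetric M a r₁))).IsFutureDirected (velocity 𝓘(ℝ, E4) γ 0))
    {t : ℝ} (ht : t ∈ dom) (h0t : 0 ≤ t) :
    0 < (γ t : E4) 0 - bentHeight M a (Kerr.radius a (γ t : E4)) + (Kerr.radius a (γ t : E4) - r₁) / 4 := by
  have hr₀ : 0 < Kerr.radius a (γ 0 : E4) := Kerr.radius_pos_of_mem_region (γ 0).2
  set L : E4 := velocity 𝓘(ℝ, E4) γ 0 with hL
  have hLL : Kerr.bilin M a (γ 0 : E4) L L = 0 := hnull.1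
  have hVL : Kerr.bilin M a (γ 0 : E4) (Kerr.timeVector M a (γ 0 : E4)) L < 0 := hfd.2
  have hL0 : 0 < L 0 := by rw [Kerr.bilin_timeVector hr₀] at hVL; linarith
  have hE : Kerr.bilin M a (γ 0 : E4) L (E4.basisVector 0) ≠ 0 := by
    have hp := (KerrLeafSojourn.energy_pinch hM a hr₀ hLL.le hL0.le).1
    have hH : Kerr.scalarH M a (γ 0 : E4) ≤ M / Kerr.radius a (γ 0 : E4) := Kerr.scalarH_le_div hM a hr₀
    have hH4 : 4 * Kerr.scalarH M a (γ 0 : E4) < 1 := by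
      have : M / Kerr.radius a (γ 0 : E4) < 1 / 4 := by
        rw [div_lt_div_iff₀ hr₀ (by norm_num : (0:ℝ) < 4)]; linarith
      linarith
    have : 0 < (1 - 4 * Kerr.scalarH M a (γ 0 : E4)) * L 0 := mul_pos (by linarith) hL0
    linarith
  have hder0 : deriv (fun σ ↦ (γ σ : E4)) 0 = L := (CollarCauchy.velocity_eq_deriv γ 0).symm
  have hcurve : (Kerr.smoothMetric M a r₁).IsFutureCausalCurveOn
      ((Kerr.timeOrientation M a r₁ hM).ofLE le_top) γ dom := by
    refine KerrLeafSojourn.ray_isFutureCausalCurveOn hM hopen hoc hgeo h0 ?_ ?_ ?_ subset_rfl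
    · rw [hder0]; exact hLL
    · rw [hder0]; exact hL0
    · rw [hder0]; exact hE
  exact curve_mem_collar ha hoc hcurve h0 hleaf.symm.le ht h0t

/-- **Lift of a maximal geodesic of the target through the chart map, from a leaf point.**  Let
`χ : Kerr.region a r₁ → N` be `C^∞` on the collar `W`, isometric there (`g(dχ v, dχ w) = g_{M,a}(v, w)`) and
oriented (`g(τ, dχ V) < 0`, `V = Kerr.timeVector`); let `x₀` be a leaf point (`x₀⁰ = T(r x₀)`) of radius `> 4M`
and `γ` a maximal geodesic of `(N, g)` on `dom ∋ 0` with `γ 0 = χ x₀` and future-directed null velocity.  Then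
the maximal chart geodesic `γ_K : dom_K` with data `(x₀, dχ⁻¹(γ' 0))` (`exists_isMaximalGeodesicOn`) has
future-directed null velocity, `dχ(γ_K' 0) = γ' 0`, and **`dom_K ∩ [0, ∞) ⊆ dom` with `γ = χ ∘ γ_K` there**:
on the component `J ∋ 0` of `{t ∈ dom_K | γ_K t ∈ W}` (which contains `dom_K ∩ [0, ∞)` by `ray_mem_collar`)
`γ_K` is a geodesic of the pulled-back metric `χ^* g` on the collar (same components `g_{M,a}`,
`isGeodesicOn_transfer`), so `χ ∘ γ_K` is a `g`-geodesic on `J` (`SimpleAH.isGeodesicOn_comp`) with the data of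
`γ`, and the maximal `g`-geodesic with these data is `γ` on `dom` (O'Neill 1983, Ch. 3, Prop. 3.24).
[cite: ONeill1983, Ch. 3, pp. 90–91] -/
theorem ray_lift (hM0 : 0 < M) (hM : 0 ≤ M) (ha : |a| < M)
    [(Kerr.smoothMetric M a r₁).HasLeviCivita] [g.HasLeviCivita]
    (hχs : ContMDiffOn 𝓘(ℝ, E4) (𝓡 4) ∞ χ
      {x | 0 < (x : E4) 0 - bentHeight M a (Kerr.radius a (x : E4)) + (Kerr.radius a (x : E4) - r₁) / 4})
    (hχg : ∀ x : Kerr.region a r₁, 0 < (x : E4) 0 - bentHeight M a (Kerr.radius a (x : E4)) +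
          (Kerr.radius a (x : E4) - r₁) / 4 →
        (∀ v w : E4, g.val (χ x) (mfderiv 𝓘(ℝ, E4) (𝓡 4) χ x v)
            (mfderiv 𝓘(ℝ, E4) (𝓡 4) χ x w) = Kerr.bilin M a (x : E4) v w) ∧
        g.val (χ x) (τ.vectorField (χ x))
            (mfderiv 𝓘(ℝ, E4) (𝓡 4) χ x (Kerr.timeVector M a (x : E4))) < 0)
    {x₀ : Kerr.region a r₁} (hx₀ : (x₀ : E4) 0 = bentHeight M a (Kerr.radius a (x₀ : E4)))
    (hfar : 4 * M < Kerr.radius a (x₀ : E4))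
    {γ : ℝ → N} {dom : Set ℝ} (hmax : IsMaximalGeodesicOn g.leviCivita γ dom) (h0 : (0 : ℝ) ∈ dom)
    (hγ0 : χ x₀ = γ 0) (hnull : g.IsNull (velocity (𝓡 4) γ 0))
    (hfd : τ.IsFutureDirected (velocity (𝓡 4) γ 0)) :
    ∃ (γK : ℝ → Kerr.region a r₁) (domK : Set ℝ),
      IsMaximalGeodesicOn (Kerr.smoothMetric M a r₁).leviCivita γK domK ∧ (0 : ℝ) ∈ domK ∧ γK 0 = x₀ ∧
      mfderiv 𝓘(ℝ, E4) (𝓡 4) χ x₀ (velocity 𝓘(ℝ, E4) γK 0) = velocity (𝓡 4) γ 0 ∧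
      (Kerr.smoothMetric M a r₁).IsNull (velocity 𝓘(ℝ, E4) γK 0) ∧
      (((Kerr.timeOrientation M a r₁ hM).ofLE le_top :
        TimeOrientation (Kerr.smoothMetric M a r₁))).IsFutureDirected (velocity 𝓘(ℝ, E4) γK 0) ∧
      (∀ t ∈ domK, 0 ≤ t → t ∈ dom ∧ χ (γK t) = γ t) := by
  -- the base point lies in the collar
  have hr₁ : r₁ < Kerr.radius a (x₀ : E4) := (le_max_left _ _).trans_lt (Kerr.mem_region.1 x₀.2)
  have hx₀W : 0 < (x₀ : E4) 0 - bentHeight M a (Kerr.radius a (x₀ : E4)) +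
      (Kerr.radius a (x₀ : E4) - r₁) / 4 := by rw [hx₀]; linarith
  obtain ⟨hiso₀, hor₀⟩ := hχg x₀ hx₀W
  have hinj₀ := injective_mfderiv_of_iso hiso₀
  -- the initial velocity pulled back to the chart
  set L : E4 := (mfderivEquivOfInjective (I := 𝓡 4) (I' := 𝓘(ℝ, E4)) χ x₀ hinj₀ rfl).symm
    (show TangentSpace (𝓡 4) (χ x₀) from velocity (𝓡 4) γ 0) with hL_def
  have hL : mfderiv 𝓘(ℝ, E4) (𝓡 4) χ x₀ L = velocity (𝓡 4) γ 0 :=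
    mfderiv_mfderivEquivOfInjective_symm χ x₀ hinj₀ rfl _
  -- `L` is null, future-directed, with positive time component and positive Killing energy
  have hLL : Kerr.bilin M a (x₀ : E4) L L = 0 := by
    have key : ∀ (q : N) (_ : q = γ 0), g.val q (show TangentSpace (𝓡 4) q from velocity (𝓡 4) γ 0)
        (show TangentSpace (𝓡 4) q from velocity (𝓡 4) γ 0) = 0 := by
      rintro q rfl; exact hnull.1
    have h := key (χ x₀) hγ0
    rw [← hL, hiso₀] at h
    exact h
  have hLfd : (((Kerr.timeOrientation M a r₁ hM).ofLE le_top :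
      TimeOrientation (Kerr.smoothMetric M a r₁))).IsFutureDirected (show TangentSpace 𝓘(ℝ, E4) x₀ from L) := by
    refine isFutureDirected_of_mfderiv_of_iso hM hiso₀ hor₀ ?_
    have key : ∀ (q : N) (_ : q = γ 0),
        τ.IsFutureDirected (show TangentSpace (𝓡 4) q from velocity (𝓡 4) γ 0) := by
      rintro q rfl; exact hfd
    have h := key (χ x₀) hγ0
    rw [← hL] at h
    exact h
  have hLne : L ≠ 0 := fun h ↦ by
    have hVL : Kerr.bilin M a (x₀ : E4) (Kerr.timeVector M a (x₀ : E4)) L < 0 := hLfd.2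
    rw [h, map_zero] at hVL; exact lt_irrefl _ hVL
  -- the maximal chart geodesic with these data
  have h2 : ((1 : ℕ∞) : ℕ∞ω) + 1 ≤ ∞ := by
    rw [show ((1 : ℕ∞) : ℕ∞ω) + 1 = 2 by norm_num]; exact WithTop.coe_le_coe.2 le_top
  haveI : CovariantDerivative.ContMDiffCovariantDerivative (Kerr.smoothMetric M a r₁).leviCivita 1 :=
    ⟨(Kerr.smoothMetric M a r₁).toPseudoRiemannianMetric.isLocallyContMDiff_leviCivita_holds 1 h2 univ
      isOpen_univ⟩
  haveI : CovariantDerivative.ContMDiffCovariantDerivative g.leviCivita 1 :=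
    ⟨g.toPseudoRiemannianMetric.isLocallyContMDiff_leviCivita_holds 1 h2 univ isOpen_univ⟩
  obtain ⟨γK, domK, hmaxK, h0K, hγK0, hγKv, -⟩ :=
    exists_isMaximalGeodesicOn (cov := (Kerr.smoothMetric M a r₁).leviCivita) x₀
      (show TangentSpace 𝓘(ℝ, E4) x₀ from L)
  have hopenK := hmaxK.isOpen
  have hocK := hmaxK.2.1
  have hgeoK := hmaxK.isGeodesicOn
  have hx0' : (γK 0 : E4) = x₀ := congrArg Subtype.val hγK0
  -- null and future-directed at `0`, read at the point `γK 0`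
  have key : ∀ (q : Kerr.region a r₁) (_ : q = x₀) (u : E4) (_ : u = L),
      (Kerr.smoothMetric M a r₁).IsNull (show TangentSpace 𝓘(ℝ, E4) q from u) ∧
      (((Kerr.timeOrientation M a r₁ hM).ofLE le_top :
        TimeOrientation (Kerr.smoothMetric M a r₁))).IsFutureDirected (show TangentSpace 𝓘(ℝ, E4) q from u) := by
    rintro q rfl u rfl
    exact ⟨⟨hLL, hLne⟩, hLfd⟩
  obtain ⟨hnullK, hfdK⟩ := key (γK 0) hγK0 _ hγKv
  -- for `t ≥ 0` the chart geodesic stays in the collar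
  have hW : ∀ t ∈ domK, 0 ≤ t → 0 < (γK t : E4) 0 - bentHeight M a (Kerr.radius a (γK t : E4)) +
      (Kerr.radius a (γK t : E4) - r₁) / 4 := fun t ht h0t ↦
    ray_mem_collar hM ha hopenK hocK hgeoK h0K (by rw [hx0', hx₀]) (by rw [hx0']; exact hfar) hnullK hfdK
      ht h0t
  -- the collar as an open subset of `E4`, and the chart map on it (extended by junk, then restricted)
  have hWo : IsOpen {x : E4 | max r₁ 0 < Kerr.radius a x ∧
      0 < x 0 - bentHeight M a (Kerr.radius a x) + (Kerr.radius a x - r₁) / 4} := by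
    have hc : Continuous fun x : E4 ↦ x 0 - bentHeight M a (Kerr.radius a x) + (Kerr.radius a x - r₁) / 4 :=
      ((PiLp.continuous_apply 2 _ 0).sub ((contDiff_bentHeight (n := ⊤) hM0 a).continuous.comp
        (Kerr.continuous_radius a))).add (((Kerr.continuous_radius a).sub continuous_const).div_const _)
    exact (isOpen_lt continuous_const (Kerr.continuous_radius a)).inter (isOpen_lt continuous_const hc)
  set W' : TopologicalSpace.Opens E4 := ⟨_, hWo⟩ with hW'
  classical
  set χt : E4 → N := fun x ↦ if h : x ∈ Kerr.region a r₁ then χ ⟨x, h⟩ else Classical.arbitrary N with hχt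
  have hχtχ : (fun x : Kerr.region a r₁ ↦ χt x) = χ := funext fun x ↦ by rw [hχt]; dsimp only; rw [dif_pos x.2]
  set f : W' → N := fun p ↦ χ ⟨p.1, p.2.1⟩ with hf_def
  have hpW : ∀ p : W', 0 < ((⟨p.1, p.2.1⟩ : Kerr.region a r₁) : E4) 0 -
      bentHeight M a (Kerr.radius a ((⟨p.1, p.2.1⟩ : Kerr.region a r₁) : E4)) +
        (Kerr.radius a ((⟨p.1, p.2.1⟩ : Kerr.region a r₁) : E4) - r₁) / 4 := fun p ↦ p.2.2
  have hfeq : f = χt ∘ Subtype.val := funext fun p ↦ by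
    rw [hf_def, Function.comp_apply, hχt]; dsimp only
    rw [dif_pos (show (p : E4) ∈ Kerr.region a r₁ from p.2.1)]
  have hχtd : ∀ p : W', ContMDiffAt 𝓘(ℝ, E4) (𝓡 4) ∞ χt p.1 := fun p ↦ by
    have h1 : ContMDiffAt 𝓘(ℝ, E4) (𝓡 4) ∞ χ ⟨p.1, p.2.1⟩ :=
      (hχs _ (hpW p)).contMDiffAt ((CollarEmbedsMGHD.collar M a r₁ hM0).isOpen.mem_nhds (hpW p))
    rw [← hχtχ] at h1
    exact (contMDiffAt_subtype_iff (U := Kerr.region a r₁) (f := χt) (x := ⟨p.1, p.2.1⟩)).1 h1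
  have hres : ContMDiff 𝓘(ℝ, E4) (𝓡 4) (∞ + 1) f := fun p ↦ by rw [hfeq]; exact contMDiffAt_subtype_iff.2 (hχtd p)
  have hmf : ∀ p : W', mfderiv 𝓘(ℝ, E4) (𝓡 4) f p = mfderiv 𝓘(ℝ, E4) (𝓡 4) χ ⟨p.1, p.2.1⟩ := fun p ↦ by
    have hd : MDifferentiableAt 𝓘(ℝ, E4) (𝓡 4) χt p.1 := (hχtd p).mdifferentiableAt (by simp)
    rw [hfeq, mfderiv_comp_subtypeVal (W := W') hd]
    conv_rhs => rw [← hχtχ]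
    exact (mfderiv_comp_subtypeVal (W := Kerr.region a r₁) (y := ⟨p.1, p.2.1⟩) hd).symm
  -- the open set of parameters at which the chart geodesic lies in the collar, and its component of `0`
  set P : Set ℝ := {t ∈ domK | (γK t : E4) ∈ W'} with hP_def
  have hmemP : ∀ {t}, t ∈ domK → (t ∈ P ↔ 0 < (γK t : E4) 0 - bentHeight M a (Kerr.radius a (γK t : E4)) +
      (Kerr.radius a (γK t : E4) - r₁) / 4) := fun {t} ht ↦
    ⟨fun h ↦ h.2.2, fun h ↦ ⟨ht, (γK t).2, h⟩⟩
  have hPopen : IsOpen P := by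
    refine isOpen_iff_mem_nhds.2 fun t ht ↦ ?_
    have hcont : ContinuousAt (fun σ ↦ (γK σ : E4)) t :=
      (KerrLeafSojourn.ray_hasDerivAt hgeoK ht.1).1.continuousAt
    have h1 : {σ | (γK σ : E4) ∈ W'} ∈ 𝓝 t := hcont.preimage_mem_nhds (W'.isOpen.mem_nhds ht.2)
    filter_upwards [hopenK.mem_nhds ht.1, h1] with σ h₁ h₂ using ⟨h₁, h₂⟩
  have h0P : (0 : ℝ) ∈ P := (hmemP h0K).2 (hW 0 h0K le_rfl)
  set J : Set ℝ := connectedComponentIn P 0 with hJ_def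
  have hJP : J ⊆ P := connectedComponentIn_subset P 0
  have hJK : J ⊆ domK := fun t ht ↦ (hJP ht).1
  have hJopen : IsOpen J := hPopen.connectedComponentIn
  have hJoc : J.OrdConnected := isPreconnected_iff_ordConnected.1 isPreconnected_connectedComponentIn
  have h0J : (0 : ℝ) ∈ J := mem_connectedComponentIn h0P
  have hAJ : domK ∩ Ici 0 ⊆ J := by
    refine (isPreconnected_iff_ordConnected.2 (hocK.inter ordConnected_Ici)).subset_connectedComponentIn
      ⟨h0K, self_mem_Ici⟩ fun t ht ↦ (hmemP ht.1).2 (hW t ht.1 ht.2)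
  -- the chart geodesic as a curve of the collar
  set c : ℝ → W' := fun t ↦ if h : (γK t : E4) ∈ W' then ⟨γK t, h⟩ else ⟨x₀, x₀.2, hx₀W⟩ with hc_def
  have hceq : ∀ t ∈ J, (c t : E4) = γK t := fun t ht ↦ by
    rw [hc_def]; dsimp only; rw [dif_pos (hJP ht).2]
  -- the collar with the pulled-back metric `χ^* g = g_{M,a}`
  have hinj : ∀ p, Injective (mfderiv 𝓘(ℝ, E4) (𝓡 4) f p) := fun p ↦ by
    rw [hmf p]; exact injective_mfderiv_of_iso (hχg _ (hpW p)).1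
  have hpb := PseudoRiemannianMetric.contMDiff_pullbackBilin_holds (I := 𝓡 4) (M := N) (I' := 𝓘(ℝ, E4))
    (N := W') (n := (∞ : ℕ∞ω))
  set gW := g.toPseudoRiemannianMetric.comap hpb f hres hinj rfl with hgW
  have hgWval : ∀ p, gW.val p = Kerr.bilin M a (p : E4) := fun p ↦ by
    ext v w
    rw [hgW, PseudoRiemannianMetric.val_comap, pullbackBilin_apply, hmf p]
    exact (hχg _ (hpW p)).1 v w
  haveI : gW.HasLeviCivita := gW.hasLeviCivita
  -- transfer of the chart geodesic to the collar, then to the target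
  obtain ⟨hcJ, hcv⟩ := isGeodesicOn_transfer (g₁ := (Kerr.smoothMetric M a r₁).toPseudoRiemannianMetric)
    (g₂ := gW) (G := Kerr.bilin M a) (fun _ ↦ rfl) hgWval (fun y ↦ Kerr.differentiableAt_bilin M a y)
    (fun p ↦ (Kerr.contDiffAt_bilin M a (Kerr.radius_pos_of_mem_region p.2.1) (n := 1)).differentiableAt
      one_ne_zero) hJopen (hgeoK.mono hJK) hceq
  obtain ⟨hχc, hχcv⟩ := Literature.Geometry.Riemannian.SimpleAH.isGeodesicOn_comp
    (hpb := hpb) (hf := hres) (hf' := hinj) (hdim := rfl) hJopen hcJ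
  -- initial data of the transported curve
  have hc0 : (⟨(c 0 : E4), (c 0).2.1⟩ : Kerr.region a r₁) = x₀ := Subtype.ext ((hceq 0 h0J).trans hx0')
  have hpos0 : (fun t ↦ f (c t)) 0 = γ 0 := by
    show χ ⟨(c 0 : E4), (c 0).2.1⟩ = γ 0
    rw [hc0]; exact hγ0
  have hvel0 : velocity (𝓡 4) (fun t ↦ f (c t)) 0 = velocity (𝓡 4) γ 0 := by
    rw [hχcv 0 h0J, hmf (c 0)]
    have h1 : (mfderiv 𝓘(ℝ, E4) (𝓡 4) χ ⟨(c 0 : E4), (c 0).2.1⟩ (velocity 𝓘(ℝ, E4) c 0) : E4) =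
        mfderiv 𝓘(ℝ, E4) (𝓡 4) χ x₀ (velocity 𝓘(ℝ, E4) c 0) :=
      Literature.Geometry.Riemannian.CartanHadamard.mfderiv_congr_point hc0 _
    have h2 : (velocity 𝓘(ℝ, E4) c 0 : E4) = L := (hcv 0 h0J).trans hγKv
    have h3 : (mfderiv 𝓘(ℝ, E4) (𝓡 4) χ x₀ (velocity 𝓘(ℝ, E4) c 0) : E4) = mfderiv 𝓘(ℝ, E4) (𝓡 4) χ x₀ L :=
      congrArg (mfderiv 𝓘(ℝ, E4) (𝓡 4) χ x₀) h2
    exact h1.trans (h3.trans hL)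
  -- the maximal geodesic of the target with the data of `γ` is `γ`, and contains the transported curve
  obtain ⟨Γ, S, hΓmax, -, -, -, hΓr⟩ :=
    exists_isMaximalGeodesicOn (cov := g.leviCivita) (γ 0) (velocity (𝓡 4) γ 0)
  obtain ⟨hdomS, hγΓ⟩ := hΓr γ dom hmax.isOpen hmax.2.1 h0 hmax.isGeodesicOn rfl rfl
  have hSdom : S = dom := hmax.2.2.2 Γ S hΓmax.isOpen hΓmax.2.1 hdomS hΓmax.isGeodesicOn hγΓ
  obtain ⟨hJS, hcΓ⟩ := hΓr (fun t ↦ f (c t)) J hJopen hJoc h0J hχc hpos0 hvel0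
  rw [hSdom] at hJS
  refine ⟨γK, domK, hmaxK, h0K, hγK0, ?_, hnullK, hfdK, fun t ht h0t ↦ ?_⟩
  · have : (velocity 𝓘(ℝ, E4) γK 0 : E4) = L := hγKv
    rw [this]; exact hL
  · have htJ : t ∈ J := hAJ ⟨ht, h0t⟩
    refine ⟨hJS htJ, ?_⟩
    have h1 := hcΓ htJ
    have h2 := hγΓ (hJS htJ)
    simp only at h1
    rw [h2, ← h1]
    show χ (γK t) = χ ⟨(c t : E4), (c t).2.1⟩
    congr 1
    exact Subtype.ext (hceq t htJ).symm

end Lift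

end ScriTransport

open ScriTransport in
/-- **Registered sub-goal `stub_scriTransportRayCollar` — null rays from the bent leaf stay in the tapered
collar.**  For sub-extremal `(M, a)`, `0 ≤ M`, a geodesic `γ` of `(Kerr.region a r₁, g_{M,a})` on an open
interval `dom ∋ 0` which starts on the bent leaf `{x⁰ = T(r)}` (`T = bentHeight M a`) at radius `> 4M` with
future-directed null velocity satisfies `0 < u(γ t) + (r(γ t) − r₁)/4` for every `t ∈ dom`, `t ≥ 0` — it never
leaves the collar `W` towards the future, so the chart map `χ` of the line sees all of its future
(`ScriTransport.ray_mem_collar`: positive Killing energy by the pinch `E ≥ (1 − 4H)γ̇⁰`, `H ≤ M/r < 1/4`, hence a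
future causal chart curve, and the causal `u`-clock `stub_scriTransportClock`). Dafermos–Rodnianski
arXiv:0811.0354, §5.1. [cite: arXiv08110354, §5.1] -/
theorem stub_scriTransportRayCollar : ∀ [Kerr.Facts] (M a r₁ : ℝ) (hM : 0 ≤ M), |a| < M →
    ∀ [(Kerr.smoothMetric M a r₁).HasLeviCivita] (γ : ℝ → Kerr.region a r₁) (dom : Set ℝ),
    IsOpen dom → dom.OrdConnected → IsGeodesicOn (Kerr.smoothMetric M a r₁).leviCivita γ dom → (0 : ℝ) ∈ dom →
    (γ 0 : E4) 0 =
      Summit.FinalStateConjecture.FinalStateConjecture.Theorems.KerrShieldedDataExist.Negative.bentHeight M a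
        (Kerr.radius a (γ 0 : E4)) →
    4 * M < Kerr.radius a (γ 0 : E4) →
    (Kerr.smoothMetric M a r₁).IsNull (velocity 𝓘(ℝ, E4) γ 0) →
    ((Kerr.timeOrientation M a r₁ hM).ofLE le_top :
      TimeOrientation (Kerr.smoothMetric M a r₁)).IsFutureDirected (velocity 𝓘(ℝ, E4) γ 0) →
    ∀ t ∈ dom, 0 ≤ t → 0 < (γ t : E4) 0 -
      Summit.FinalStateConjecture.FinalStateConjecture.Theorems.KerrShieldedDataExist.Negative.bentHeight M a
        (Kerr.radius a (γ t : E4)) + (Kerr.radius a (γ t : E4) - r₁) / 4 :=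
  fun _ _ _ hM ha _ γ _ hopen hoc hgeo h0 hleaf hfar hnull hfd _ ht h0t ↦
    ray_mem_collar (γ := γ) hM ha hopen hoc hgeo h0 hleaf hfar hnull hfd ht h0t

end Summit.FinalStateConjecture.FinalStateConjecture.Theorems.SwallowTheDatum.KerrShieldedSettles

end
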